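import Literature.Computability.QuantumComplexity.CWrapProg
import Literature.Computability.QuantumComplexity.WireConjugation
import HarnessLib

/-!
# Classical wrapping inside quantum search, III: the wrapped family and the matrices of its stages

Trunk `CryptoQuantFine`; third file of the construction discharging
`Literature.Computability.Cryptography.isQSolvable_classicalWrap` (plan in `CWrapLayout.lean`).
The circuit on inputs of length `n`, on `n + anc n` wires (`CWrapProg.lean`):

  `stage1 n ++ (⨁_{ℓ ≤ L(n)} (conjGates n ℓ ++ copyGates n ℓ ++ conjGates n ℓ)) ++ stage2 n`,

where `stage1/stage2` are the exact Clifford+T compilations (`revCompile`) of `prog1/prog2`,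
`conjGates n ℓ` that of the swap of the front window with block `ℓ`, and `copyGates n ℓ` is the
given circuit `F.circ ℓ` placed verbatim on the front wires `0 … ℓ + F.ancillas ℓ - 1`. This
file defines the family `CWrap.family` (ancillas `anc`), proves it oracle-free, and computes the
matrices of the classical stages on basis states:

* `toMatrix_stage1_mulVec_basisState` (stage 1 maps `|x 0…0⟩` to the basis state `|w1 x⟩` of
  `CWrapProg.lean`, `basisState_pad_eq`);
* `conjInvol` — the wire involution exchanging the front window and block `ℓ`, and
  `toMatrix_conjGates_mulVec_basisState`: the compiled swap permutes basis states along it;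
  hence `toMatrix_conjBlock`: swap–copy–swap computes `F.circ ℓ` placed on block `ℓ`
  (`WireConjugation.toMatrix_conj_mapWires`);
* `perm2` — stage 2 as an injective self-map of the basis labels, `toMatrix_stage2_mulVec_basisState`.

## References

* E. Bernstein, U. Vazirani, *Quantum complexity theory*, SIAM J. Comput. 26 (1997), §8.
* M. A. Nielsen, I. L. Chuang, *Quantum Computation and Quantum Information*, CUP 2010, §1.3.4,
  §3.2.5, §4.3.
* S. Arora, B. Barak, *Computational Complexity: A Modern Approach*, CUP 2009, §10.3.7 Lemma 10.10.
-/

noncomputable section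

namespace Literature.Computability.QuantumComplexity

namespace CWrap

open _root_.Computability Complexity Complexity.FinTM2Sim Turing Function RevSim RevClean Cryptography RevMux Matrix

variable (P : Params)

/-! ### The circuits -/

/-- The copy of length `ℓ` fits: `ℓ + F.ancillas ℓ ≤ n + anc n` for `ℓ ≤ L(n)`. [folklore] -/
theorem copy_fits {n ℓ : ℕ} (hℓ : ℓ ≤ Lh P.toLayout n) : ℓ + P.F.ancillas ℓ ≤ n + anc P n :=
  (le_Pw P.toLayout hℓ).trans ((Pw_le_baseB _ n).trans ((baseB_le_D _ n).trans (by rw [n_add_anc]; exact (D_lt_widthG P n).le)))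

/-- The front window fits: `Pw n ≤ n + anc n`. [folklore] -/
theorem Pw_fits (n : ℕ) : Pw P.toLayout n ≤ n + anc P n :=
  (Pw_le_baseB _ n).trans ((baseB_le_D _ n).trans (by rw [n_add_anc]; exact (D_lt_widthG P n).le))

/-- **The conjugating swap of block `ℓ`**, compiled (empty beyond `L(n)`). [cite: NielsenChuang2010, §1.3.4 (swap from three CNOTs)] -/
def conjGates (n ℓ : ℕ) : List (QGate cliffordT (n + anc P n)) :=
  if h : ℓ ≤ Lh P.toLayout n then revCompile (clamp P n (progConj P n ℓ) (progConj_lt' P h) (progConj_wf P n ℓ)) else []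

/-- **The copy of length `ℓ`**: `F.circ ℓ` on the front wires, verbatim (empty beyond `L(n)`).
[cite: AroraBarak2009, §6.2 (a circuit for each input length, hard-wired)] -/
def copyGates (n ℓ : ℕ) : List (QGate cliffordT (n + anc P n)) :=
  if h : ℓ ≤ Lh P.toLayout n then (mapWires (Fin.castLEEmb (copy_fits P h)) (P.F.circ ℓ)).gates else []

/-- The quantum stage: for every `ℓ ≤ L(n)`, swap, copy, swap back. [folklore] -/
def stageQ (n : ℕ) : List (QGate cliffordT (n + anc P n)) :=
  (List.range (Lh P.toLayout n + 1)).flatMap fun ℓ => conjGates P n ℓ ++ (copyGates P n ℓ ++ conjGates P n ℓ)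

/-- Stage 1, compiled. [folklore] -/
def stage1 (n : ℕ) : List (QGate cliffordT (n + anc P n)) :=
  revCompile (clamp P n (prog1 P n) (prog1_lt' P n) (prog1_wf P n))

/-- Stage 2, compiled. [folklore] -/
def stage2 (n : ℕ) : List (QGate cliffordT (n + anc P n)) :=
  revCompile (clamp P n (prog2 P n) (prog2_lt' P n) (prog2_wf P n))

/-- **The circuit of the wrapped family on inputs of length `n`.** [cite: BernsteinVazirani1997, §8 (classical computation inside quantum machines)] -/
def circ (n : ℕ) : QCircuit cliffordT (n + anc P n) := ⟨stage1 P n ++ (stageQ P n ++ stage2 P n)⟩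

/-- **The wrapped family.** [cite: BernsteinVazirani1997, §8 (classical computation inside quantum machines)] -/
def family : QCircuitFamily cliffordT := ⟨anc P, circ P⟩

/-- The circuit of the family (definitional). [folklore] -/
@[simp] theorem family_circ (n : ℕ) : (family P).circ n = circ P n := rfl

/-- The ancillas of the family (definitional). [folklore] -/
@[simp] theorem family_ancillas (n : ℕ) : (family P).ancillas n = anc P n := rfl

/-- **The wrapped family is oracle-free** (if the given one is). [folklore] -/
theorem family_isOracleFree (hF : P.F.IsOracleFree) : (family P).IsOracleFree := by
  intro n g hg
  have hg' : g ∈ stage1 P n ++ (stageQ P n ++ stage2 P n) := hg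
  rcases List.mem_append.1 hg' with h | h
  · exact revCompile_isOracleFree (clamp P n (prog1 P n) (prog1_lt' P n) (prog1_wf P n)) g h
  rcases List.mem_append.1 h with h | h
  · obtain ⟨ℓ, -, h⟩ := List.mem_flatMap.1 h
    have hconj : g ∈ conjGates P n ℓ → g.IsOracleFree := fun h => by
      unfold conjGates at h
      split_ifs at h with hℓ
      · exact revCompile_isOracleFree (clamp P n (progConj P n ℓ) (progConj_lt' P hℓ) (progConj_wf P n ℓ)) g h
      · exact absurd h List.not_mem_nil
    rcases List.mem_append.1 h with h | h
    · exact hconj h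
    rcases List.mem_append.1 h with h | h
    · unfold copyGates at h
      split_ifs at h with hℓ
      · exact isOracleFree_mapWires _ (hF ℓ) g h
      · exact absurd h List.not_mem_nil
    · exact hconj h
  · exact revCompile_isOracleFree (clamp P n (prog2 P n) (prog2_lt' P n) (prog2_wf P n)) g h

/-! ### Stage 1 on the input -/

/-- The padded input, extended to `ℕ`, is the string `x` followed by zeros. [folklore] -/
theorem liftW_padInput_get (x : List Bool) (m : ℕ) : liftW (padInput x.get m) = strW x := by
  funext i
  unfold liftW strW padInput
  by_cases hi : i < x.length + m
  · rw [dif_pos hi]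
    by_cases hix : i < x.length
    · rw [show (⟨i, hi⟩ : Fin (x.length + m)) = Fin.castAdd m ⟨i, hix⟩ from rfl, Fin.append_left,
        List.getD_eq_getElem?_getD, List.getElem?_eq_getElem hix]
      rfl
    · have him : i - x.length < m := by omega
      rw [show (⟨i, hi⟩ : Fin (x.length + m)) = Fin.natAdd x.length ⟨i - x.length, him⟩ from Fin.ext (by simp; omega),
        Fin.append_right, List.getD_eq_getElem?_getD, List.getElem?_eq_none (Nat.not_lt.1 hix)]
      rfl
  · rw [dif_neg hi, List.getD_eq_getElem?_getD, List.getElem?_eq_none (by omega)]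
    rfl

/-- **Stage 1 on a basis state.** [cite: AroraBarak2009, §10.3.7 Lemma 10.10] -/
theorem toMatrix_stage1_mulVec_basisState (A : Language Bool) (n : ℕ) (w : QReg (n + anc P n)) :
    (⟨stage1 P n⟩ : QCircuit cliffordT (n + anc P n)).toMatrix A *ᵥ basisState w =
      basisState (fun p => clEval (prog1 P n) (liftW w) p) := by
  rw [stage1, revCompile_mulVec_basisState]
  congr 1
  funext p
  exact revEval_clamp P n _ _ _ w p

/-- The basis label after stage 1 on the input `x`: the assignment `w1 x` of `CWrapProg.lean`.
[folklore] -/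
def W1 (x : List Bool) : QReg (x.length + anc P x.length) := fun p => w1 P x p

/-- **Stage 1 on the input `|x 0…0⟩` yields `|w1 x⟩`.** [cite: AroraBarak2009, §10.3.7 Lemma 10.10] -/
theorem toMatrix_stage1_mulVec_pad (A : Language Bool) (x : List Bool) :
    (⟨stage1 P x.length⟩ : QCircuit cliffordT (x.length + anc P x.length)).toMatrix A *ᵥ
        basisState (padInput x.get (anc P x.length)) = basisState (W1 P x) := by
  rw [toMatrix_stage1_mulVec_basisState, liftW_padInput_get]
  rfl

/-! ### The conjugating swap -/

section Conj

variable {P} {n ℓ : ℕ} (hℓ : ℓ ≤ Lh P.toLayout n)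

/-- The block of `ℓ` starts beyond the front window. [folklore] -/
theorem Pw_le_blockW (n ℓ i : ℕ) : Pw P.toLayout n ≤ blockW P.toLayout n ℓ i :=
  (Pw_le_baseB _ n).trans (baseB_le_blockW _ n ℓ i)

include hℓ in
/-- Block wires fit. [folklore] -/
theorem blockW_fits {i : ℕ} (hi : i < Pw P.toLayout n) : blockW P.toLayout n ℓ i < n + anc P n := by
  rw [n_add_anc]; exact (blockW_lt_D _ hℓ hi).trans (D_lt_widthG P n)

/-- **The wire involution of the conjugating swap**: front wire `i < Pw` ↔ wire `i` of block
`ℓ`, all other wires fixed. [cite: NielsenChuang2010, §1.3.4 (swap from three CNOTs)] -/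
def conjInvol (hℓ : ℓ ≤ Lh P.toLayout n) (p : Fin (n + anc P n)) : Fin (n + anc P n) :=
  if h1 : (p : ℕ) < Pw P.toLayout n then ⟨blockW P.toLayout n ℓ p, blockW_fits hℓ h1⟩
  else if h2 : blockW P.toLayout n ℓ 0 ≤ p ∧ (p : ℕ) < blockW P.toLayout n ℓ 0 + Pw P.toLayout n then
    ⟨p - blockW P.toLayout n ℓ 0, by have := p.isLt; omega⟩
  else p

/-- `blockW n ℓ i = blockW n ℓ 0 + i`. [folklore] -/
theorem blockW_eq_add (n ℓ i : ℕ) : blockW P.toLayout n ℓ i = blockW P.toLayout n ℓ 0 + i := by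
  unfold blockW; omega

/-- `conjInvol` on a front wire. [folklore] -/
theorem conjInvol_of_lt {p : Fin (n + anc P n)} (hp : (p : ℕ) < Pw P.toLayout n) :
    (conjInvol hℓ p : ℕ) = blockW P.toLayout n ℓ p := by
  unfold conjInvol; rw [dif_pos hp]

/-- `conjInvol` on a block wire. [folklore] -/
theorem conjInvol_blockW {i : ℕ} (hi : i < Pw P.toLayout n) :
    (conjInvol hℓ ⟨blockW P.toLayout n ℓ i, blockW_fits hℓ hi⟩ : ℕ) = i := by
  have h1 : ¬ blockW P.toLayout n ℓ i < Pw P.toLayout n := Nat.not_lt.2 (Pw_le_blockW n ℓ i)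
  have h2 : blockW P.toLayout n ℓ 0 ≤ blockW P.toLayout n ℓ i ∧ blockW P.toLayout n ℓ i < blockW P.toLayout n ℓ 0 + Pw P.toLayout n := by
    rw [blockW_eq_add n ℓ i]; omega
  unfold conjInvol
  rw [dif_neg h1, dif_pos h2]
  simp [blockW_eq_add n ℓ i]

/-- `conjInvol` elsewhere. [folklore] -/
theorem conjInvol_of_not {p : Fin (n + anc P n)} (hp : ¬ (p : ℕ) < Pw P.toLayout n)
    (hp' : ¬ (blockW P.toLayout n ℓ 0 ≤ p ∧ (p : ℕ) < blockW P.toLayout n ℓ 0 + Pw P.toLayout n)) :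
    conjInvol hℓ p = p := by
  unfold conjInvol; rw [dif_neg hp, dif_neg hp']

/-- **`conjInvol` is an involution.** [folklore] -/
theorem conjInvol_conjInvol (p : Fin (n + anc P n)) : conjInvol hℓ (conjInvol hℓ p) = p := by
  have hPw := Pw_le_blockW (P := P) n ℓ 0
  by_cases h1 : (p : ℕ) < Pw P.toLayout n
  · have e : conjInvol hℓ p = ⟨blockW P.toLayout n ℓ p, blockW_fits hℓ h1⟩ := by unfold conjInvol; rw [dif_pos h1]
    rw [e]
    exact Fin.ext (conjInvol_blockW hℓ h1)
  · by_cases h2 : blockW P.toLayout n ℓ 0 ≤ p ∧ (p : ℕ) < blockW P.toLayout n ℓ 0 + Pw P.toLayout n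
    · have hi : (p : ℕ) - blockW P.toLayout n ℓ 0 < Pw P.toLayout n := by omega
      have e : conjInvol hℓ p = ⟨p - blockW P.toLayout n ℓ 0, by have := p.isLt; omega⟩ := by
        unfold conjInvol; rw [dif_neg h1, dif_pos h2]
      rw [e]
      apply Fin.ext
      rw [conjInvol_of_lt hℓ (by exact hi)]
      simp only
      rw [blockW_eq_add n ℓ]; omega
    · rw [conjInvol_of_not hℓ h1 h2, conjInvol_of_not hℓ h1 h2]

/-- **The compiled conjugating swap permutes basis states along `conjInvol`.** [cite: NielsenChuang2010, §1.3.4 (swap from three CNOTs)] -/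
theorem toMatrix_conjGates_mulVec_basisState (A : Language Bool) (w : QReg (n + anc P n)) :
    (⟨conjGates P n ℓ⟩ : QCircuit cliffordT (n + anc P n)).toMatrix A *ᵥ basisState w = basisState (w ∘ conjInvol hℓ) := by
  unfold conjGates
  rw [dif_pos hℓ, revCompile_mulVec_basisState]
  congr 1
  funext p
  rw [revEval_clamp]
  unfold progConj
  -- the hypotheses of `clEval_swapOps`
  have h1 : ((conjPairs P n ℓ).map Prod.fst).Nodup := by
    rw [conjPairs, List.map_map]; simpa [Function.comp_def] using List.nodup_range
  have h2 : ((conjPairs P n ℓ).map Prod.snd).Nodup := by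
    rw [conjPairs, List.map_map]
    exact List.nodup_range.map_on fun a _ b _ h => blockW_injective P.toLayout n ℓ h
  have h12 : ∀ q ∈ conjPairs P n ℓ, ∀ q' ∈ conjPairs P n ℓ, q.1 ≠ q'.2 := by
    intro q hq q' hq'
    simp only [conjPairs, List.mem_map, List.mem_range] at hq hq'
    obtain ⟨i, hi, rfl⟩ := hq; obtain ⟨i', -, rfl⟩ := hq'
    exact Nat.ne_of_lt (lt_of_lt_of_le hi (Pw_le_blockW n ℓ i'))
  obtain ⟨hsnd, hfst, hother⟩ := clEval_swapOps (conjPairs P n ℓ) h1 h2 h12 (liftW w)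
  simp only [Function.comp_apply]
  by_cases hp : (p : ℕ) < Pw P.toLayout n
  · -- a front wire receives the block wire
    have hmem : ((p : ℕ), blockW P.toLayout n ℓ p) ∈ conjPairs P n ℓ := List.mem_map.2 ⟨p, List.mem_range.2 hp, rfl⟩
    rw [hfst _ hmem]
    change liftW w (blockW P.toLayout n ℓ p) = w (conjInvol hℓ p)
    rw [← liftW_val w (conjInvol hℓ p), conjInvol_of_lt hℓ hp]
  · by_cases hp2 : blockW P.toLayout n ℓ 0 ≤ p ∧ (p : ℕ) < blockW P.toLayout n ℓ 0 + Pw P.toLayout n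
    · -- a block wire receives the front wire
      have hi : (p : ℕ) - blockW P.toLayout n ℓ 0 < Pw P.toLayout n := by omega
      have hpe : (p : ℕ) = blockW P.toLayout n ℓ (p - blockW P.toLayout n ℓ 0) := by rw [blockW_eq_add n ℓ]; omega
      have hmem : ((p : ℕ) - blockW P.toLayout n ℓ 0, (p : ℕ)) ∈ conjPairs P n ℓ :=
        List.mem_map.2 ⟨_, List.mem_range.2 hi, by rw [← hpe]⟩
      rw [hsnd _ hmem]
      change liftW w ((p : ℕ) - blockW P.toLayout n ℓ 0) = w (conjInvol hℓ p)
      rw [← liftW_val w (conjInvol hℓ p)]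
      congr 1
      unfold conjInvol; rw [dif_neg hp, dif_pos hp2]
    · rw [hother _ (fun q hq => ?_), conjInvol_of_not hℓ hp hp2, liftW_val]
      simp only [conjPairs, List.mem_map, List.mem_range] at hq
      obtain ⟨i, hi, rfl⟩ := hq
      refine ⟨fun h => hp (h ▸ hi), fun h => hp2 ?_⟩
      rw [h, blockW_eq_add n ℓ i]; omega

/-- The block embedding of length `ℓ`: position `i` of the copy ↦ wire `i` of block `ℓ`.
[folklore] -/
def blockEmbLen (hℓ : ℓ ≤ Lh P.toLayout n) : Fin (ℓ + P.F.ancillas ℓ) ↪ Fin (n + anc P n) :=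
  (Fin.castLEEmb (copy_fits P hℓ)).trans (invEmb (conjInvol hℓ) (conjInvol_conjInvol hℓ))

/-- `blockEmbLen` lands in block `ℓ`. [folklore] -/
theorem blockEmbLen_apply (i : Fin (ℓ + P.F.ancillas ℓ)) : (blockEmbLen hℓ i : ℕ) = blockW P.toLayout n ℓ i := by
  have hi : (i : ℕ) < Pw P.toLayout n := lt_of_lt_of_le i.isLt (le_Pw _ hℓ)
  simp only [blockEmbLen, Function.Embedding.trans_apply, invEmb_apply]
  exact conjInvol_of_lt hℓ (by simpa using hi)

/-- **Swap–copy–swap computes the copy on block `ℓ`.** [cite: NielsenChuang2010, §4.3 (a gate on a subset of the wires is U ⊗ 1 up to the order of the factors)] -/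
theorem toMatrix_conjBlock (A : Language Bool) :
    (⟨conjGates P n ℓ ++ (copyGates P n ℓ ++ conjGates P n ℓ)⟩ : QCircuit cliffordT (n + anc P n)).toMatrix A =
      (mapWires (blockEmbLen hℓ) (P.F.circ ℓ)).toMatrix A := by
  have hcopy : copyGates P n ℓ = (mapWires (Fin.castLEEmb (copy_fits P hℓ)) (P.F.circ ℓ)).gates := by
    unfold copyGates; rw [dif_pos hℓ]
  rw [hcopy, toMatrix_conj_mapWires A (conjInvol hℓ) (conjInvol_conjInvol hℓ) (conjGates P n ℓ)
    (toMatrix_conjGates_mulVec_basisState hℓ A) (Fin.castLEEmb (copy_fits P hℓ)) (P.F.circ ℓ)]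
  rfl

end Conj

/-! ### Stage 2 as a permutation of the basis labels -/

/-- **Stage 2 as an injective self-map of the basis labels.** [cite: NielsenChuang2010, §3.2.5 (reversible classical computation on basis states)] -/
def perm2 (n : ℕ) : QReg (n + anc P n) ↪ QReg (n + anc P n) :=
  ⟨revEval (clamp P n (prog2 P n) (prog2_lt' P n) (prog2_wf P n)), by
    unfold clamp
    intro a b h
    rw [revEval_toRevList, revEval_toRevList] at h
    exact clEval_injective _ (fun op hop => by
      simp only [List.mem_map] at hop
      obtain ⟨op, hop, rfl⟩ := hop
      exact wf_map_finOf _ (prog2_lt' P n op hop) (prog2_wf P n op hop)) h⟩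

/-- `perm2` evaluated: the `ℕ`-program on the lifted assignment. [folklore] -/
theorem perm2_apply (n : ℕ) (z : QReg (n + anc P n)) (p : Fin (n + anc P n)) :
    perm2 P n z p = clEval (prog2 P n) (liftW z) p :=
  revEval_clamp P n _ _ _ z p

/-- **Stage 2 permutes basis states along `perm2`.** [cite: AroraBarak2009, §10.3.7 Lemma 10.10] -/
theorem toMatrix_stage2_mulVec_basisState (A : Language Bool) (n : ℕ) (z : QReg (n + anc P n)) :
    (⟨stage2 P n⟩ : QCircuit cliffordT (n + anc P n)).toMatrix A *ᵥ basisState z = basisState (perm2 P n z) := by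
  rw [stage2, revCompile_mulVec_basisState]
  rfl

end CWrap

end Literature.Computability.QuantumComplexity

end
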